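import Summits.ResolutionOfSingularities.ResolutionOfSingularities.Theorems.FrobeniusClosingPatchingRelPerfectDepthHSepComponents
import HarnessLib

/-!
# Crux `PatchingRelPerfect` (stmt-ResolutionOfSingularities-16161), chain W5.2 — rung R5ᴴ, hand N4 «END components»,
# EXPONENT-FUNCTION FORM (res-L1-w52-plan-1 INTERFACE RULING G11-4)

[OURS · L1 W5.2 · R5ᴴ N4 (owner res-D-pv-055; hand res-D-pv-054; consumer N5 `…DepthHSepPeel`, res-D-pv-016 AS stub-5)]
Fact-free except the named antecedent `CossartJannsenSaito2020EmbeddedSequenceB` (F-32bR) of the last theorem; NOT statements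
of the manuscript under review (Hironaka 2017); AI-written, weaker than expert review.

The factor-list presentations of `HSepCJS.components_of_cjsB` (`p.1 = monomialIdeal q`, factors of `q` in ONE snc family `𝓔`)
are rewritten in the exponent-FUNCTION form consumed by the PEEL loop N5 (`HSepPeel.monoOf 𝓔 c = monomialIdeal (𝓔.map fun S
=> (S, c S))`, stated here UNFOLDED): after deduplicating `𝓔` (`HasSNC` passes to sub-families), a factor list over a `Nodup`
family is the monomial of the exponent function summing the exponents of each member (commutative-monoid bookkeeping:
`monomialIdeal_expFun_zero/_add/_single`, `exists_expFun_of_factors`). Export: `components_of_cjsB_expFun`.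

## References
* J. Kollár, *Lectures on Resolution of Singularities* (2007), (3.111) Step 3. [Kollar2007]
* V. Cossart, U. Jannsen, S. Saito, LNM 2270 (2020), Thm. 1.4. [CossartJannsenSaito2020]
-/

-- `Summit.<Summit>.<Sub>.Theorems` with `Sub = Summit` (single-conjunct summit, D-0017)
set_option linter.dupNamespace false

noncomputable section

open CategoryTheory CategoryTheory.Limits AlgebraicGeometry TopologicalSpace IsLocalRing
open Literature.AlgebraicGeometry.Resolution Scheme.IdealSheafData

namespace Summit.ResolutionOfSingularities.ResolutionOfSingularities.Theorems

universe u

namespace HSepCJS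

open DepthTargets

/-! ## §1 Monomials of exponent functions -/

section ExpFun

variable {X : Scheme.{u}}

/-- The monomial of the zero exponent function is the unit ideal. [folklore] -/
theorem monomialIdeal_expFun_zero (𝓔 : List X.IdealSheafData) :
    monomialIdeal (𝓔.map fun S => (S, (0 : X.IdealSheafData → ℕ) S)) = ⊤ := by
  induction 𝓔 with
  | nil => rw [List.map_nil, Literature.AlgebraicGeometry.Resolution.monomialIdeal_nil]
  | cons S 𝓔 ih =>
    rw [List.map_cons, monomialIdeal_cons, ih, Pi.zero_apply, pow_zero, Scheme.IdealSheafData.one_eq_top,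
      Scheme.IdealSheafData.top_mul]

/-- The monomial of a sum of exponent functions is the product of the monomials. [folklore] -/
theorem monomialIdeal_expFun_add (𝓔 : List X.IdealSheafData) (c d : X.IdealSheafData → ℕ) :
    monomialIdeal (𝓔.map fun S => (S, (c + d) S)) =
      monomialIdeal (𝓔.map fun S => (S, c S)) * monomialIdeal (𝓔.map fun S => (S, d S)) := by
  induction 𝓔 with
  | nil => rw [List.map_nil, List.map_nil, List.map_nil, Literature.AlgebraicGeometry.Resolution.monomialIdeal_nil, Scheme.IdealSheafData.top_mul]
  | cons S 𝓔 ih =>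
    simp only [List.map_cons, monomialIdeal_cons]
    rw [ih, Pi.add_apply, pow_add, mul_mul_mul_comm]

/-- Over a family WITHOUT DUPLICATES, the monomial of the exponent function concentrated at a member `T` with value `n` is
`T ^ n`. [folklore] -/
theorem monomialIdeal_expFun_single [DecidableEq X.IdealSheafData] {𝓔 : List X.IdealSheafData} (hnd : 𝓔.Nodup)
    {T : X.IdealSheafData} (hT : T ∈ 𝓔) (n : ℕ) :
    monomialIdeal (𝓔.map fun S => (S, (if S = T then n else 0))) = T ^ n := by
  induction 𝓔 with
  | nil => exact absurd hT List.not_mem_nil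
  | cons S 𝓔 ih =>
    rw [List.nodup_cons] at hnd
    rw [List.map_cons, monomialIdeal_cons]
    rcases List.mem_cons.mp hT with rfl | hT'
    · -- `T` is the head: the tail carries exponent `0`
      have htail : (𝓔.map fun S => (S, (if S = T then n else 0))) = 𝓔.map fun S => (S, (0 : X.IdealSheafData → ℕ) S) := by
        apply List.map_congr_left
        intro S hS
        have hST : S ≠ T := fun h => hnd.1 (h ▸ hS)
        rw [if_neg hST, Pi.zero_apply]
      rw [if_pos rfl, htail, monomialIdeal_expFun_zero, Scheme.IdealSheafData.mul_top]
    · have hST : S ≠ T := fun h => hnd.1 (h ▸ hT')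
      rw [if_neg hST, pow_zero, Scheme.IdealSheafData.one_eq_top, Scheme.IdealSheafData.top_mul]
      exact ih hnd.2 hT'

/-- **A factor list over a `Nodup` family is the monomial of an exponent function** (sum the exponents of each member).
[folklore] -/
theorem exists_expFun_of_factors {𝓔 : List X.IdealSheafData} (hnd : 𝓔.Nodup) (q : List (X.IdealSheafData × ℕ))
    (hq : ∀ f ∈ q, f.1 ∈ 𝓔) :
    ∃ c : X.IdealSheafData → ℕ, monomialIdeal q = monomialIdeal (𝓔.map fun S => (S, c S)) := by
  classical
  induction q with
  | nil => exact ⟨0, by rw [Literature.AlgebraicGeometry.Resolution.monomialIdeal_nil, monomialIdeal_expFun_zero]⟩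
  | cons f q ih =>
    obtain ⟨c, hc⟩ := ih fun g hg => hq g (List.mem_cons_of_mem _ hg)
    refine ⟨(fun S => if S = f.1 then f.2 else 0) + c, ?_⟩
    rw [monomialIdeal_cons, hc, monomialIdeal_expFun_add,
      monomialIdeal_expFun_single hnd (hq f List.mem_cons_self) f.2]

/-- Simple normal crossings pass to the deduplicated family (same members). [folklore] -/
theorem hasSNC_dedup [DecidableEq X.IdealSheafData] {𝓔 : List X.IdealSheafData} (h : HasSNC 𝓔) : HasSNC 𝓔.dedup :=
  h.of_subset fun _ hD => List.mem_dedup.mp hD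

end ExpFun

/-! ## §2 The N4 EXPORT in the exponent-function form (INTERFACE RULING G11-4) -/

/-- [OURS · L1 W5.2 · R5ᴴ N4] **CJS ⇒ HSepSeq with END COMPONENTS, exponent-function form** (MODULO F-32bR =
`CossartJannsenSaito2020EmbeddedSequenceB`, a named antecedent; res-L1-w52-plan-1 INTERFACE RULING G11-4 = the three hypotheses of
the PEEL loop N5 plus exponent-FUNCTION witnesses): on an integral Noetherian regular excellent scheme `W` of dimension three,
every effective Cartier `D` with `ℓ ≥ 1` is carried by an `HSepSeq` from `[(D, ℓ)]` to a list `𝒟₁` on an integral Noetherian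
regular `W₁` carrying ONE family `𝓔` of ideal sheaves with simple normal crossings, WITHOUT DUPLICATES, whose non-unit members
have preconnected supports, such that EVERY member of `𝒟₁` is `monomialIdeal (𝓔.map fun S => (S, c S))` for some exponent
function `c` (that is `HSepPeel.monoOf 𝓔 c`, unfolded). [cite: CossartJannsenSaito2020, Thm. 1.4]
[cite: Kollar2007, (3.111) Step 3] [cite: StacksProject, Tag 0BIA] -/
theorem components_of_cjsB_expFun (hCJS : CossartJannsenSaito2020EmbeddedSequenceB.{u}) (W : Scheme.{u}) [IsIntegral W]
    [IsNoetherian W] (hreg : Scheme.IsRegular W) (hexc : Scheme.IsExcellent W) (hdim : topologicalKrullDim W = 3)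
    (D : W.IdealSheafData) (hD : IsEffectiveCartier D) (ℓ : ℕ) (hℓ : 1 ≤ ℓ) :
    ∃ (W₁ : Scheme.{u}) (ρ : W₁ ⟶ W) (_ : IsIntegral W₁) (_ : IsNoetherian W₁) (𝒟₁ : List (W₁.IdealSheafData × ℕ))
      (𝓔 : List W₁.IdealSheafData),
      HSepSeq ρ [(D, ℓ)] 𝒟₁ ∧ Scheme.IsRegular W₁ ∧ HasSNC 𝓔 ∧ 𝓔.Nodup ∧
      (∀ S ∈ 𝓔, S ≠ ⊤ → _root_.IsPreconnected (S.support : Set W₁)) ∧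
      (∀ p ∈ 𝒟₁, IsEffectiveCartier p.1) ∧
      (∀ p ∈ 𝒟₁, ∃ c : W₁.IdealSheafData → ℕ, p.1 = monomialIdeal (𝓔.map fun S => (S, c S))) := by
  classical
  obtain ⟨W₁, ρ, hint, hnoeth, 𝒟₁, 𝓔, hseq, hW₁, h𝓔, -, hirr, -, hmem⟩ :=
    components_of_cjsB hCJS W hreg hexc hdim D hD ℓ hℓ
  refine ⟨W₁, ρ, hint, hnoeth, 𝒟₁, 𝓔.dedup, hseq, hW₁, hasSNC_dedup h𝓔, List.nodup_dedup 𝓔,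
    fun S hS _ => (hirr S (List.mem_dedup.mp hS)).isConnected.isPreconnected, fun p hp => (hmem p hp).1, fun p hp => ?_⟩
  obtain ⟨-, -, q, hq, hpq⟩ := hmem p hp
  obtain ⟨c, hc⟩ := exists_expFun_of_factors (List.nodup_dedup 𝓔) q fun f hf => List.mem_dedup.mpr (hq f hf)
  exact ⟨c, hpq.trans hc⟩

end HSepCJS

end Summit.ResolutionOfSingularities.ResolutionOfSingularities.Theorems

end
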